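import Summits.NavierStokesRegularity.NavierStokesRegularity.Theorems.FrequencyRigidity.Negative.Clauses

/-!
# `FrequencyRigidity` (crux `stmt-NavierStokesRegularity-2955`): (T) structure of the frequency
# clause — constant frequency ⇔ exact power law; the exponent is pinned to `Λ₀ = 2`
# — negative-side support (refuter, cdisprove), file 4

For the frequency clause `FreqClause v K Λ₀` of the crux (`Negative/Clauses.lean`):
* `FreqClause.differentiableAt` — `Λ₀ ≠ 0` forces differentiability of the adapted enstrophy
  `H(t) = ∫ ‖curl v(t)‖² K(t)` at every `t < 0` (otherwise Mathlib's `deriv` is the junk `0` and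
  `Λ t = 0`).
* `FreqClause.power_law` — constant frequency ⇔ EXACT power law `H(t) = H(−1)(−t)^{−Λ₀}`
  (`(H(−t)^{Λ₀})' = 0` on the connected open set `(−∞,0)`).
* `exponent_le_two_of_bound_near_zero`, `two_le_exponent_of_bound_near_infty`,
  `FreqClause.exponent_eq_two` — under the two-ended enstrophy bound `H(t) ≤ M(−t)^{−2}` (for an
  honest ancient Type-I flow a consequence of the scale-invariant gradient estimate
  `|∇v(t)| ≲ (−t)^{−1}` and `∫ K = 1`) the exponent is PINNED to the self-similar value `Λ₀ = 2`.
Consequences.  A counterexample to the crux must reproduce the backward self-similar enstrophy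
law `H(t) = A(−t)^{−2}` on the nose (on a `λ`-DSS flow `(−t)²H(t)` is `log λ`-periodic and only
exceptionally constant); a prover may reduce to the equality case `Λ₀ = 2`.  Caveat: for `Λ₀ = 0`
the clause alone does not force `H` constant (a singular monotone `H` has `deriv H ≡ 0`); `H` of
a smooth flow is smooth, so this is not exploitable by a witness.

## References

* C.-C. Poon, *Unique continuation for parabolic equations*, Comm. PDE 21 (1996) 521–539. [Poon1996]
* G. Koch, N. Nadirashvili, G. Seregin, V. Šverák, Acta Math. 203 (2009) 83–105. [KochNadirashviliSereginSverak2009]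
-/

noncomputable section

set_option linter.dupNamespace false

namespace Summit.NavierStokesRegularity.NavierStokesRegularity.Theorems.FrequencyRigidity.Negative

open Literature.Analysis.FluidPDE Literature.Analysis.UnboundedOperators
open MeasureTheory Set Filter Topology Function
open scoped Laplacian InnerProductSpace RealInnerProductSpace ContDiff

/-! ### (T) Structure of the frequency clause: constant frequency ⇔ exact power law; the
exponent is pinned to the self-similar value `Λ₀ = 2` by two-ended enstrophy bounds -/

/-- If the frequency clause holds with `Λ₀ ≠ 0`, the adapted enstrophy is differentiable at every
`t < 0`: otherwise Mathlib's `deriv` is the junk value `0` there and `Λ t = 0 ≠ Λ₀`. -/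
theorem FreqClause.differentiableAt {v : ℝ → E3 → E3} {K : ℝ → E3 → ℝ} {Λ₀ : ℝ}
    (h : FreqClause v K Λ₀) (hΛ : Λ₀ ≠ 0) {t : ℝ} (ht : t < 0) :
    DifferentiableAt ℝ (fun t => ∫ x, ‖curl (v t) x‖ ^ 2 * K t x) t := by
  by_contra hd
  have h1 := (h _ _ rfl rfl).2 t ht
  simp only [deriv_zero_of_not_differentiableAt hd, mul_zero, zero_div] at h1
  exact hΛ h1.symm

/-- **Constant frequency ⇔ exact power law.**  If the frequency clause holds with constant `Λ₀`
and the adapted enstrophy `H` is differentiable on `(−∞,0)` (automatic when `Λ₀ ≠ 0`,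
`FreqClause.differentiableAt`), then `H(t) = H(−1) · (−t)^{−Λ₀}` for every `t < 0`
(`(H · (−t)^{Λ₀})' = (−t)^{Λ₀−1} ((−t)H' − Λ₀ H) = 0` on the connected open set `(−∞,0)`). -/
theorem FreqClause.power_law {v : ℝ → E3 → E3} {K : ℝ → E3 → ℝ} {Λ₀ : ℝ}
    (h : FreqClause v K Λ₀)
    (hd : ∀ t < 0, DifferentiableAt ℝ (fun t => ∫ x, ‖curl (v t) x‖ ^ 2 * K t x) t)
    {t : ℝ} (ht : t < 0) :
    (∫ x, ‖curl (v t) x‖ ^ 2 * K t x) =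
      (∫ x, ‖curl (v (-1)) x‖ ^ 2 * K (-1) x) * (-t) ^ (-Λ₀) := by
  set H : ℝ → ℝ := fun t => ∫ x, ‖curl (v t) x‖ ^ 2 * K t x with hH
  have hcl := h H _ rfl rfl
  -- the ODE `(−s) H'(s) = Λ₀ H(s)` on `s < 0`
  have hode : ∀ s < 0, (0 - s) * deriv H s = Λ₀ * H s := fun s hs => by
    have h1 := hcl.2 s hs
    have hpos := hcl.1 s hs
    field_simp at h1
    linarith [h1]
  -- `G s = H s * (−s)^Λ₀` has zero derivative on `(−∞,0)`
  set G : ℝ → ℝ := fun s => H s * (-s) ^ Λ₀ with hG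
  have hGd : ∀ s < 0, HasDerivAt G 0 s := fun s hs => by
    have hHs : HasDerivAt H (deriv H s) s := (hd s hs).hasDerivAt
    have hps : HasDerivAt (fun r : ℝ => (-r) ^ Λ₀) ((-1) * Λ₀ * (-s) ^ (Λ₀ - 1)) s :=
      (hasDerivAt_neg s).rpow_const (Or.inl (by linarith))
    have := hHs.mul hps
    refine this.congr_deriv ?_
    have hs' : (-s) ^ Λ₀ = (-s) ^ (Λ₀ - 1) * (-s) := by
      rw [← Real.rpow_add_one (by linarith : (-s) ≠ 0), sub_add_cancel]
    rw [hs']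
    linear_combination (-s) ^ (Λ₀ - 1) * hode s hs
  have hGconst : G t = G (-1) :=
    IsOpen.is_const_of_deriv_eq_zero isOpen_Iio (convex_Iio 0).isPreconnected
      (fun s hs => (hGd s hs).differentiableAt.differentiableWithinAt)
      (fun s hs => (hGd s hs).deriv) ht (by norm_num)
  have hG1 : G (-1) = H (-1) := by simp [hG]
  have hpow : (-t) ^ Λ₀ * (-t) ^ (-Λ₀) = 1 := by
    rw [Real.rpow_neg (by linarith), mul_inv_cancel₀]
    exact (Real.rpow_pos_of_pos (by linarith) _).ne'
  calc H t = G t * (-t) ^ (-Λ₀) := by simp only [hG]; rw [mul_assoc, hpow, mul_one]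
    _ = H (-1) * (-t) ^ (-Λ₀) := by rw [hGconst, hG1]

/-- Power-law comparison near `s → 0⁺`: `A s^{−Λ₀} ≤ M s^{−2}` on `(0,1)` with `A > 0` forces
`Λ₀ ≤ 2`. -/
theorem exponent_le_two_of_bound_near_zero {A M Λ₀ : ℝ} (hA : 0 < A)
    (h : ∀ s ∈ Ioo (0:ℝ) 1, A * s ^ (-Λ₀) ≤ M * s ^ (-(2:ℝ))) : Λ₀ ≤ 2 := by
  by_contra hΛ'
  have hΛ : 2 < Λ₀ := not_le.mp hΛ'
  -- `N ↦ N^{Λ₀-2} → ∞`; pick `N > 1` with `N^{Λ₀-2} > M/A` and test `s = N⁻¹`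
  have ht := tendsto_rpow_atTop (show 0 < Λ₀ - 2 by linarith)
  obtain ⟨N, hN1, hN⟩ := ((eventually_gt_atTop (1:ℝ)).and (ht.eventually_gt_atTop (M / A))).exists
  have hN0 : 0 < N := by linarith
  have hs : N⁻¹ ∈ Ioo (0:ℝ) 1 := ⟨inv_pos.2 hN0, inv_lt_one_of_one_lt₀ hN1⟩
  have h1 := h _ hs
  rw [Real.inv_rpow hN0.le, Real.inv_rpow hN0.le, Real.rpow_neg hN0.le, Real.rpow_neg hN0.le,
    inv_inv, inv_inv] at h1
  -- h1 : A * N ^ Λ₀ ≤ M * N ^ 2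
  have h2 : N ^ (Λ₀ - 2) * N ^ (2:ℝ) = N ^ Λ₀ := by
    rw [← Real.rpow_add hN0, sub_add_cancel]
  have h3 : 0 < N ^ (2:ℝ) := Real.rpow_pos_of_pos hN0 _
  have h4 : M / A < N ^ (Λ₀ - 2) := hN
  rw [div_lt_iff₀ hA] at h4
  nlinarith [mul_lt_mul_of_pos_right h4 h3]

/-- Power-law comparison near `s → ∞`: `A s^{−Λ₀} ≤ M s^{−2}` on `(1,∞)` with `A > 0` forces
`2 ≤ Λ₀`. -/
theorem two_le_exponent_of_bound_near_infty {A M Λ₀ : ℝ} (hA : 0 < A)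
    (h : ∀ s : ℝ, 1 < s → A * s ^ (-Λ₀) ≤ M * s ^ (-(2:ℝ))) : 2 ≤ Λ₀ := by
  by_contra hΛ'
  have hΛ : Λ₀ < 2 := not_le.mp hΛ'
  have ht := tendsto_rpow_atTop (show 0 < 2 - Λ₀ by linarith)
  obtain ⟨N, hN1, hN⟩ := ((eventually_gt_atTop (1:ℝ)).and (ht.eventually_gt_atTop (M / A))).exists
  have hN0 : 0 < N := by linarith
  have h1 := h N hN1
  rw [Real.rpow_neg hN0.le, Real.rpow_neg hN0.le] at h1
  have h2 : N ^ (2 - Λ₀) * N ^ Λ₀ = N ^ (2:ℝ) := by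
    rw [← Real.rpow_add hN0, sub_add_cancel]
  have h3 : 0 < N ^ Λ₀ := Real.rpow_pos_of_pos hN0 _
  have h5 : 0 < N ^ (2:ℝ) := Real.rpow_pos_of_pos hN0 _
  have h4 : M / A < N ^ (2 - Λ₀) := hN
  rw [div_lt_iff₀ hA] at h4
  -- from h1: A / N^Λ₀ ≤ M / N^2, i.e. A N^2 ≤ M N^Λ₀
  have h6 : A * N ^ (2:ℝ) ≤ M * N ^ Λ₀ := by
    have := h1
    rw [← div_eq_mul_inv, ← div_eq_mul_inv, div_le_div_iff₀ h3 h5] at this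
    linarith
  nlinarith [mul_lt_mul_of_pos_right h4 h3]

/-- **The exponent is pinned to the self-similar value.**  If the frequency clause holds, the
adapted enstrophy is differentiable on `(−∞,0)` (automatic for `Λ₀ ≠ 0`) and obeys the two-ended
Type-I ENSTROPHY bound `H(t) ≤ M (−t)^{−2}` for all `t < 0` — which for an honest ancient
Type-I flow follows from the scale-invariant gradient estimate `|∇v(t)| ≲ (−t)^{−1}` and
`∫ K = 1` — then `Λ₀ = 2` and `H(t) = H(−1)(−t)^{−2}` EXACTLY: a counterexample must reproduce
the backward self-similar enstrophy law on the nose (`(−t)² H(t)` is what is log-periodic and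
generically non-constant on a `λ`-DSS flow), and a prover may reduce to the equality case
`Λ₀ = 2`. -/
theorem FreqClause.exponent_eq_two {v : ℝ → E3 → E3} {K : ℝ → E3 → ℝ} {Λ₀ M : ℝ}
    (h : FreqClause v K Λ₀)
    (hd : ∀ t < 0, DifferentiableAt ℝ (fun t => ∫ x, ‖curl (v t) x‖ ^ 2 * K t x) t)
    (hM : ∀ t < 0, (∫ x, ‖curl (v t) x‖ ^ 2 * K t x) ≤ M * (-t) ^ (-(2:ℝ))) : Λ₀ = 2 := by
  set A : ℝ := ∫ x, ‖curl (v (-1)) x‖ ^ 2 * K (-1) x with hA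
  have hApos : 0 < A := (h _ _ rfl rfl).1 (-1) (by norm_num)
  have hlaw : ∀ s : ℝ, 0 < s → A * s ^ (-Λ₀) ≤ M * s ^ (-(2:ℝ)) := fun s hs => by
    have h1 := h.power_law hd (show -s < 0 by linarith)
    have h2 := hM (-s) (by linarith)
    rw [h1, neg_neg] at h2
    exact h2
  exact le_antisymm (exponent_le_two_of_bound_near_zero hApos fun s hs => hlaw s hs.1)
    (two_le_exponent_of_bound_near_infty hApos fun s hs => hlaw s (by linarith))

end Summit.NavierStokesRegularity.NavierStokesRegularity.Theorems.FrequencyRigidity.Negative
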